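import Literature.NumberTheory.EllipticCurves.PAdicLFunctionNeZeroHoldsProofs
import Literature.NumberTheory.EllipticCurves.PAdicLFunctionInterpolationProofs
import Literature.NumberTheory.EllipticCurves.ModularSymbolsHeckeProofs
import Literature.NumberTheory.EllipticCurves.ModularFormsGamma0Genus
import HarnessLib

/-!
# Stub `stub_birch` (line `Sketch` = `kurihara-fourier-support`, crux `PlecticLegs.TwistSupply`)

**Evenness and Birch's formula for a primitive character with non-zero twisted plus-symbol sum.**
Let `f ∈ S₂(Γ₀(N))` be the newform of the elliptic curve `W / ℚ` (`IsNewformOf W f`, so `f` is a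
normalised newform with rational coefficients `aₙ(f) = aₙ(W)`), `[r]⁺ = ratPlusSymbol f r ∈ ℚ` its
rational plus symbol, and `χ` a primitive Dirichlet character mod `d` with
`S = ∑_{b mod d} χ(b) [b/d]⁺ ≠ 0`. Then

* (A) `χ` is **even**: `[-r]⁺ = [r]⁺` by the very definition
  `plusSymbol f r = ({∞, r} + {∞, -r})/2` (`birch_ratPlusSymbol_neg`), and `[r + 1]⁺ = [r]⁺`
  (`ratPlusSymbol_add_intCast_holds`), so `[(-b)/d]⁺ = [b/d]⁺` for `b : ZMod d`
  (`birch_ratPlusSymbol_neg_val`); reindexing the sum by `b ↦ -b` gives `S = χ(-1) S`, and an odd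
  `χ` would force `S = -S = 0` (`birch_even_of_sum_ne_zero`);
* (B) **`L(W, χ̄, 1) ≠ 0`**: let `L` be the entire continuation of
  `L(f, χ⁻¹, s) = ∑ χ⁻¹(n) aₙ(f) n⁻ˢ = ∑ χ⁻¹(n) aₙ(W) n⁻ˢ`
  (`exists_differentiable_eq_twistedLSeries_holds`, Shimura 1971, Thm. 3.66). Birch's formula for
  the rational plus symbols (`ratTwistedSymbolSum_mul_plusPeriod_holds`, Mazur–Tate–Teitelbaum 1986,
  §I.8 (8.6): for even primitive `χ`, `S · Ω⁺_f = τ(χ) · L(1)`) together with `Ω⁺_f > 0`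
  (`IsNewform0.plusPeriod_pos_holds`) gives `τ(χ) L(1) = S Ω⁺_f ≠ 0`, hence `L(1) ≠ 0` — no
  non-vanishing of the Gauss sum is needed.
-/

noncomputable section

set_option linter.dupNamespace false

namespace Summit.BirchSwinnertonDyer.BirchSwinnertonDyer.Theorems

open CongruenceSubgroup WeierstrassCurve Literature.NumberTheory.EllipticCurves
  Literature.NumberTheory.EllipticCurves.ModularForms

open scoped MatrixGroups ModularForm

/-! ### Evenness of the rational plus symbol -/

/-- `plusSymbol f (-r) = plusSymbol f r`: immediate from
`plusSymbol f r = ({∞, r}_f + {∞, -r}_f) / 2`. -/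
theorem birch_plusSymbol_neg {N : ℕ} (f : CuspForm (Gamma0 N) 2) (r : ℚ) :
    plusSymbol f (-r) = plusSymbol f r := by
  rw [plusSymbol, plusSymbol, neg_neg, add_comm]

/-- `[-r]⁺_f = [r]⁺_f` for the rational plus symbol: both are the same `dif` over
`normalizedPlusSymbol f (±r) = re (plusSymbol f (±r)) / Ω⁺_f`, and `plusSymbol f (-r) = plusSymbol f r`. -/
theorem birch_ratPlusSymbol_neg {N : ℕ} (f : CuspForm (Gamma0 N) 2) (r : ℚ) :
    ratPlusSymbol f (-r) = ratPlusSymbol f r := by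
  have h : normalizedPlusSymbol f (-r) = normalizedPlusSymbol f r := by
    rw [normalizedPlusSymbol, normalizedPlusSymbol, birch_plusSymbol_neg]
  unfold ratPlusSymbol
  rw [h]

/-- `[(-b)/d]⁺_f = [b/d]⁺_f` for `b : ZMod d` (representatives `val ∈ [0, d)`): for `b ≠ 0`,
`(-b).val / d = (d - b.val)/d = -(b.val/d) + 1`, and `[·]⁺` is `1`-periodic
(`ratPlusSymbol_add_intCast_holds`) and even (`birch_ratPlusSymbol_neg`). -/
theorem birch_ratPlusSymbol_neg_val {N : ℕ} [NeZero N] (f : CuspForm (Gamma0 N) 2) {d : ℕ}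
    [NeZero d] (b : ZMod d) :
    ratPlusSymbol f (((-b).val : ℚ) / d) = ratPlusSymbol f ((b.val : ℚ) / d) := by
  rcases eq_or_ne b 0 with rfl | hb
  · rw [neg_zero]
  · rw [ZMod.neg_val, if_neg hb, Nat.cast_sub (ZMod.val_lt b).le]
    have hd : (d : ℚ) ≠ 0 := by exact_mod_cast NeZero.ne d
    have h : ((d : ℚ) - b.val) / d = -((b.val : ℚ) / d) + ((1 : ℤ) : ℚ) := by
      field_simp
      ring
    rw [h, ratPlusSymbol_add_intCast_holds (f := f), birch_ratPlusSymbol_neg]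

/-- **A character with non-zero twisted plus-symbol sum is even**: if
`∑_{b mod d} χ(b) [b/d]⁺_f ≠ 0` then `χ(-1) = 1`. Indeed reindexing by `b ↦ -b` and using
`[(-b)/d]⁺ = [b/d]⁺` (`birch_ratPlusSymbol_neg_val`), an odd `χ` would give `S = -S`, i.e. `S = 0`. -/
theorem birch_even_of_sum_ne_zero {N : ℕ} [NeZero N] (f : CuspForm (Gamma0 N) 2) {d : ℕ}
    [NeZero d] (χ : DirichletCharacter ℂ d)
    (hS : (∑ b : ZMod d, χ b * ((ratPlusSymbol f ((b.val : ℚ) / d) : ℚ) : ℂ)) ≠ 0) : χ.Even := by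
  rcases χ.even_or_odd with he | ho
  · exact he
  · exfalso
    apply hS
    set S := ∑ b : ZMod d, χ b * ((ratPlusSymbol f ((b.val : ℚ) / d) : ℚ) : ℂ) with hSdef
    have h : S = -S :=
      calc S = ∑ b : ZMod d, χ (-b) * ((ratPlusSymbol f (((-b).val : ℚ) / d) : ℚ) : ℂ) :=
            (Equiv.sum_comp (Equiv.neg (ZMod d))
              (fun b ↦ χ b * ((ratPlusSymbol f ((b.val : ℚ) / d) : ℚ) : ℂ))).symm
        _ = ∑ b : ZMod d, -(χ b * ((ratPlusSymbol f ((b.val : ℚ) / d) : ℚ) : ℂ)) :=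
            Finset.sum_congr rfl fun b _ ↦ by
              rw [DirichletCharacter.Odd.eval_neg χ b ho, birch_ratPlusSymbol_neg_val, neg_mul]
        _ = -S := Finset.sum_neg_distrib _
    have h2 : (2 : ℂ) * S = 0 := by linear_combination h
    exact (mul_eq_zero.mp h2).resolve_left two_ne_zero

/-! ### The stub -/

/-- **Evenness and Birch's formula** (registered stub `stub_birch` of line `Sketch`; Birch 1971;
Mazur–Tate–Teitelbaum 1986, §I.8 (8.6)): for the newform `f` of `W / ℚ` and a primitive `χ` mod `d`
with `S = ∑_{b mod d} χ(b) [b/d]⁺_f ≠ 0`, the character `χ` is even (`birch_even_of_sum_ne_zero`)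
and the entire continuation `L` of `∑ χ̄(n) aₙ(W) n⁻ˢ` (`exists_differentiable_eq_twistedLSeries_holds`
for `χ⁻¹`, with `aₙ(f) = aₙ(W)` from `IsNewformOf`) satisfies `L(1) ≠ 0`, because
`τ(χ) L(1) = S · Ω⁺_f` (`ratTwistedSymbolSum_mul_plusPeriod_holds`) with `Ω⁺_f > 0`
(`IsNewform0.plusPeriod_pos_holds`). -/
theorem stub_birch :
    ∀ (W : WeierstrassCurve ℚ) [W.IsElliptic] (N : ℕ) [NeZero N] (f : CuspForm (Gamma0 N) 2),
      IsNewformOf W f → ∀ (d : ℕ) [NeZero d] (χ : DirichletCharacter ℂ d), χ.IsPrimitive →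
      (∑ b : ZMod d, χ b * ((ratPlusSymbol f ((b.val : ℚ) / d) : ℚ) : ℂ)) ≠ 0 →
      χ.Even ∧
        ∃ L : ℂ → ℂ, Differentiable ℂ L ∧
          (∀ s : ℂ, 2 < s.re → L s = LSeries (fun n ↦ χ⁻¹ n * ((W.LFunction n : ℤ) : ℂ)) s) ∧
          L 1 ≠ 0 := by
  intro W _ N _ f hf d _ χ hχ hS
  have he : χ.Even := birch_even_of_sum_ne_zero f χ hS
  refine ⟨he, ?_⟩
  obtain ⟨L, hL, hL'⟩ := exists_differentiable_eq_twistedLSeries_holds f χ⁻¹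
  refine ⟨L, hL, fun s hs ↦ ?_, ?_⟩
  · -- `L(f, χ⁻¹, s) = ∑ χ⁻¹(n) aₙ(W) n⁻ˢ` since `aₙ(f) = aₙ(W)`
    rw [hL' s hs, twistedLSeries]
    congr 1
    funext n
    rw [hf.2 n]
  · -- Birch: `S · Ω⁺_f = τ(χ) · L(1)` with `S ≠ 0`, `Ω⁺_f ≠ 0`
    have hQ : coeffField f = ⊥ := hf.coeffField_eq_bot
    have hB := ratTwistedSymbolSum_mul_plusPeriod_holds hf.1 hQ hχ he hL hL'
    have hΩ : (plusPeriod f : ℂ) ≠ 0 :=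
      Complex.ofReal_ne_zero.mpr (IsNewform0.plusPeriod_pos_holds hf.1 hQ).ne'
    have hne : ratTwistedSymbolSum f χ * (plusPeriod f : ℂ) ≠ 0 := mul_ne_zero hS hΩ
    rw [hB] at hne
    exact right_ne_zero_of_mul hne

end Summit.BirchSwinnertonDyer.BirchSwinnertonDyer.Theorems

end
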